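import Mathlib
import Summits.ValiantsHypothesis.ValiantsHypothesis.Theorems.NewtonUnitEquationsDissociatedUniformTotalsLawConvexUnion
import Summits.ValiantsHypothesis.ValiantsHypothesis.Theorems.NewtonUnitEquationsDissociatedUniformTotalsLawUnimodalGraphs
import HarnessLib

/-!
# Crux `NewtonUnitEquations.DissociatedUniform` (stmt-ValiantsHypothesis-5905): the constant `2` of the pointwise union bound is FALSE on the convexly ordered stratum

Companion of `…TotalsLawConvexUnion`, which typed the located rung `@[conjecture] ConvexUnionVertBound C` (for both curves
convexly ordered and EVERY fibre set, `#vert conv U_s(W) ≤ C·q`) and recorded the census «`C = 2` holds in all data and is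
attained» (memo `Cruxes/DissociatedUniform/NOTES-t1g5.md` §3–§4(C)), proving only `2 ≤ C` (`two_le_of_convexUnionVertBound`).

This file REFUTES the constant `2` by an explicit pair of CENSUS PARABOLAS over `ℤ/4`:
`a k = (k, k²)`, `b k = (4k, 2k²)` (natural labels `k = 0,1,2,3`; both convexly ordered by `convexlyOrdered_parabola`), positions
`Z = {0,1,2}`, class `s = 2` — i.e. the union of the three fibres `x + y ∈ {0,1,2}` (the fibre `x + y = 3` removed).  Its `12`
points carry `9 > 8 = 2q` hull vertices, each certified by an integer weight for which it is the strict top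
(`IsStrictTop.mem_extremePoints` of the tree):
`(0,0)`, `(4,2)`, `(5,3)`, `(8,8)`, `(10,12)`, `(13,19)`, `(14,22)`, `(15,27)`, `(2,4)`.
Hence `not_convexUnionVertBound_two : ¬ ConvexUnionVertBound 2` and `three_le_of_convexUnionVertBound : ConvexUnionVertBound C → 3 ≤ C`.

How found (local exact integer hulls, seconds; memo NOTES-t1g6 §2): removing ONE fibre from the Minkowski configuration already
gives `2q + 1` vertices for generic strictly convex pairs (`q = 11`: `23`); annealing shapes and positions reaches `4q − 2|W|`
for `|W| ∈ {q−1, q−2}` (`q ≤ 13`) and `2.5·q` at `q = 12` (`W = ℤ/12 ∖ (2 + 3ℤ)`), so the true constant of the rung lies in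
`[5/2, 4]` (the upper bound `4q − 2|W|` is the candidate count of the chain localisation, memo §3).
Honest label: a kernel refutation of a conjectured CONSTANT on a stratum; `ConvexUnionVertBound C` for `C ≥ 3`, `UnionTotalsLaw`,
`TotalsLawThree` remain OPEN; nothing here bears on VP ≠ VNP.
[folklore]
-/

set_option linter.dupNamespace false -- `ValiantsHypothesis.ValiantsHypothesis` (summit = problem) in every name

open scoped BigOperators Pointwise

namespace Summit.ValiantsHypothesis.ValiantsHypothesis.Theorems.NewtonUnitEquationsDissociatedUniform

namespace TotalsLaw

open Literature.Computability.AlgebraicComplexity.KPTT.PlanarMinkowski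

namespace CexFour

/-- The first census parabola over `ℤ/4`: `a k = (k, k²)` on the natural labels `k = 0, 1, 2, 3`. -/
noncomputable def pA : ZMod 4 → (Fin 2 → ℝ) := fun z => ![1 * (z.val : ℝ), 1 * (z.val : ℝ) ^ 2]

/-- The second census parabola over `ℤ/4`: `b k = (4k, 2k²)`. -/
noncomputable def pB : ZMod 4 → (Fin 2 → ℝ) := fun z => ![4 * (z.val : ℝ), 2 * (z.val : ℝ) ^ 2]

/-- The position set `Z = {0, 1, 2}`: with class `s = 2` the present fibres are `x + y ∈ {0, 1, 2}` (the fibre `3` is removed). -/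
def posZ : Finset (ZMod 4) := {0, 1, 2}

/-- `a` is convexly ordered (a census parabola). -/
theorem convexlyOrdered_pA : ConvexlyOrdered pA := convexlyOrdered_parabola 1 1

/-- `b` is convexly ordered (a census parabola). -/
theorem convexlyOrdered_pB : ConvexlyOrdered pB := convexlyOrdered_parabola 4 2

/-- The four labels of `ℤ/4`. [folklore] -/
theorem vals4 : ∀ z : ZMod 4, z = 0 ∨ z = 1 ∨ z = 2 ∨ z = 3 := by decide

/-- Label values, cast to `ℝ`. [folklore] -/
theorem v0 : ((0 : ZMod 4).val : ℝ) = 0 := by rw [ZMod.val_zero, Nat.cast_zero]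
/-- Label values, cast to `ℝ`. [folklore] -/
theorem v1 : ((1 : ZMod 4).val : ℝ) = 1 := by rw [show (1 : ZMod 4).val = 1 from rfl]; norm_num
/-- Label values, cast to `ℝ`. [folklore] -/
theorem v2 : ((2 : ZMod 4).val : ℝ) = 2 := by rw [show (2 : ZMod 4).val = 2 from rfl]; norm_num
/-- Label values, cast to `ℝ`. [folklore] -/
theorem v3 : ((3 : ZMod 4).val : ℝ) = 3 := by rw [show (3 : ZMod 4).val = 3 from rfl]; norm_num

/-- The points of `a`. -/
theorem pA0 : pA 0 = ![0, 0] := by unfold pA; rw [v0]; norm_num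
/-- The points of `a`. -/
theorem pA1 : pA 1 = ![1, 1] := by unfold pA; rw [v1]; norm_num
/-- The points of `a`. -/
theorem pA2 : pA 2 = ![2, 4] := by unfold pA; rw [v2]; norm_num
/-- The points of `a`. -/
theorem pA3 : pA 3 = ![3, 9] := by unfold pA; rw [v3]; norm_num
/-- The points of `b`. -/
theorem pB0 : pB 0 = ![0, 0] := by unfold pB; rw [v0]; norm_num
/-- The points of `b`. -/
theorem pB1 : pB 1 = ![4, 2] := by unfold pB; rw [v1]; norm_num
/-- The points of `b`. -/
theorem pB2 : pB 2 = ![8, 8] := by unfold pB; rw [v2]; norm_num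
/-- The points of `b`. -/
theorem pB3 : pB 3 = ![12, 18] := by unfold pB; rw [v3]; norm_num

/-- Pairing of explicit planar vectors. [folklore] -/
theorem dot2 (c d e f : ℝ) : ![c, d] ⬝ᵥ ![e, f] = c * e + d * f := by
  simp [dotProduct, Fin.sum_univ_two]

/-- Sum of explicit planar vectors. [folklore] -/
theorem vadd2 (c d e f : ℝ) : ![c, d] + ![e, f] = ![c + e, d + f] := by
  ext i; fin_cases i <;> simp

/-- Equality of explicit planar vectors. [folklore] -/
theorem vec2_eq_iff (c d e f : ℝ) : (![c, d] = ![e, f]) ↔ (c = e ∧ d = f) := by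
  constructor
  · intro h
    exact ⟨by simpa using congrFun h 0, by simpa using congrFun h 1⟩
  · rintro ⟨rfl, rfl⟩; rfl

/-- The twelve points of the union `U_2(Z)` (three fibres of four points). -/
noncomputable def U12 : Finset (Fin 2 → ℝ) :=
  {![0, 0], ![1, 1], ![2, 4], ![4, 2], ![5, 3], ![7, 11], ![8, 8], ![10, 12], ![11, 17], ![13, 19], ![14, 22], ![15, 27]}

/-- Membership in the Finset model of a fibre union. [folklore] -/
theorem mem_unionFin_iff {q : ℕ} [NeZero q] (a b : ZMod q → (Fin 2 → ℝ)) (Z : Finset (ZMod q)) (s : ZMod q) (p : Fin 2 → ℝ) :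
    p ∈ unionFin a b (Z : Set (ZMod q)) s ↔ ∃ x y : ZMod q, s - x - y ∈ Z ∧ p = a x + b y := by
  rw [← Finset.mem_coe, coe_unionFin, mem_unionPts]
  simp only [Finset.mem_coe]

/-- Every point of the union is one of the twelve listed points. -/
theorem mem_U12_of_mem {p : Fin 2 → ℝ} (hp : p ∈ unionFin pA pB (posZ : Set (ZMod 4)) 2) : p ∈ U12 := by
  obtain ⟨x, y, h, rfl⟩ := (mem_unionFin_iff pA pB posZ 2 p).1 hp
  rcases vals4 x with rfl | rfl | rfl | rfl <;> rcases vals4 y with rfl | rfl | rfl | rfl <;>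
    first
    | exact absurd h (by decide)
    | (simp only [pA0, pA1, pA2, pA3, pB0, pB1, pB2, pB3, vadd2, U12, Finset.mem_insert, Finset.mem_singleton, vec2_eq_iff]
       norm_num)

/-- A pair with a present fibre gives a point of the union. -/
theorem mem_of_pair (x y : ZMod 4) (h : (2 : ZMod 4) - x - y ∈ posZ) (p : Fin 2 → ℝ) (hp : pA x + pB y = p) :
    p ∈ unionFin pA pB (posZ : Set (ZMod 4)) 2 :=
  (mem_unionFin_iff pA pB posZ 2 _).2 ⟨x, y, h, hp.symm⟩

/-- **Certificate ⇒ vertex**: a point of the union that beats the other eleven listed points for some weight is a hull vertex of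
`U_2(Z)`. -/
theorem mem_extremePoints_of_cert (w p : Fin 2 → ℝ) (hp : p ∈ unionFin pA pB (posZ : Set (ZMod 4)) 2)
    (hcert : ∀ y ∈ U12, y ≠ p → w ⬝ᵥ y < w ⬝ᵥ p) :
    p ∈ (convexHull ℝ (unionPts pA pB (posZ : Set (ZMod 4)) 2)).extremePoints ℝ := by
  have hst : IsStrictTop w (unionFin pA pB (posZ : Set (ZMod 4)) 2) p :=
    ⟨hp, fun y hy hne => hcert y (mem_U12_of_mem hy) hne⟩
  rw [← coe_unionFin pA pB (posZ : Set (ZMod 4)) 2]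
  exact hst.mem_extremePoints

/-- The nine certified vertices. -/
noncomputable def V9 : Finset (Fin 2 → ℝ) :=
  {![0, 0], ![4, 2], ![5, 3], ![8, 8], ![10, 12], ![13, 19], ![14, 22], ![15, 27], ![2, 4]}

/-- The nine listed points are pairwise distinct. -/
theorem card_V9 : V9.card = 9 := by
  simp only [V9]
  norm_num [vec2_eq_iff]

/-- **Each of the nine points is a hull vertex of `U_2(Z)`** (integer weight certificates `(-1,0)`, `(2,-3)`, `(3,-2)`,
`(7,-4)`, `(9,-4)`, `(5,-2)`, `(4,-1)`, `(0,1)`, `(-9,5)`). -/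
theorem V9_subset_extremePoints :
    (V9 : Set (Fin 2 → ℝ)) ⊆ (convexHull ℝ (unionPts pA pB (posZ : Set (ZMod 4)) 2)).extremePoints ℝ := by
  intro p hp
  simp only [V9, Finset.coe_insert, Finset.coe_singleton, Set.mem_insert_iff, Set.mem_singleton_iff] at hp
  rcases hp with rfl | rfl | rfl | rfl | rfl | rfl | rfl | rfl | rfl
  · refine mem_extremePoints_of_cert ![-1, 0] _ (mem_of_pair 0 0 (by decide) _ (by rw [pA0, pB0, vadd2]; norm_num)) ?_
    intro y hy hne
    simp only [U12, Finset.mem_insert, Finset.mem_singleton] at hy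
    rcases hy with rfl | rfl | rfl | rfl | rfl | rfl | rfl | rfl | rfl | rfl | rfl | rfl <;>
      (simp only [dot2, ne_eq, vec2_eq_iff] at hne ⊢; try (norm_num at hne); try norm_num)
  · refine mem_extremePoints_of_cert ![2, -3] _ (mem_of_pair 0 1 (by decide) _ (by rw [pA0, pB1, vadd2]; norm_num)) ?_
    intro y hy hne
    simp only [U12, Finset.mem_insert, Finset.mem_singleton] at hy
    rcases hy with rfl | rfl | rfl | rfl | rfl | rfl | rfl | rfl | rfl | rfl | rfl | rfl <;>
      (simp only [dot2, ne_eq, vec2_eq_iff] at hne ⊢; try (norm_num at hne); try norm_num)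
  · refine mem_extremePoints_of_cert ![3, -2] _ (mem_of_pair 1 1 (by decide) _ (by rw [pA1, pB1, vadd2]; norm_num)) ?_
    intro y hy hne
    simp only [U12, Finset.mem_insert, Finset.mem_singleton] at hy
    rcases hy with rfl | rfl | rfl | rfl | rfl | rfl | rfl | rfl | rfl | rfl | rfl | rfl <;>
      (simp only [dot2, ne_eq, vec2_eq_iff] at hne ⊢; try (norm_num at hne); try norm_num)
  · refine mem_extremePoints_of_cert ![7, -4] _ (mem_of_pair 0 2 (by decide) _ (by rw [pA0, pB2, vadd2]; norm_num)) ?_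
    intro y hy hne
    simp only [U12, Finset.mem_insert, Finset.mem_singleton] at hy
    rcases hy with rfl | rfl | rfl | rfl | rfl | rfl | rfl | rfl | rfl | rfl | rfl | rfl <;>
      (simp only [dot2, ne_eq, vec2_eq_iff] at hne ⊢; try (norm_num at hne); try norm_num)
  · refine mem_extremePoints_of_cert ![9, -4] _ (mem_of_pair 2 2 (by decide) _ (by rw [pA2, pB2, vadd2]; norm_num)) ?_
    intro y hy hne
    simp only [U12, Finset.mem_insert, Finset.mem_singleton] at hy
    rcases hy with rfl | rfl | rfl | rfl | rfl | rfl | rfl | rfl | rfl | rfl | rfl | rfl <;>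
      (simp only [dot2, ne_eq, vec2_eq_iff] at hne ⊢; try (norm_num at hne); try norm_num)
  · refine mem_extremePoints_of_cert ![5, -2] _ (mem_of_pair 1 3 (by decide) _ (by rw [pA1, pB3, vadd2]; norm_num)) ?_
    intro y hy hne
    simp only [U12, Finset.mem_insert, Finset.mem_singleton] at hy
    rcases hy with rfl | rfl | rfl | rfl | rfl | rfl | rfl | rfl | rfl | rfl | rfl | rfl <;>
      (simp only [dot2, ne_eq, vec2_eq_iff] at hne ⊢; try (norm_num at hne); try norm_num)
  · refine mem_extremePoints_of_cert ![4, -1] _ (mem_of_pair 2 3 (by decide) _ (by rw [pA2, pB3, vadd2]; norm_num)) ?_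
    intro y hy hne
    simp only [U12, Finset.mem_insert, Finset.mem_singleton] at hy
    rcases hy with rfl | rfl | rfl | rfl | rfl | rfl | rfl | rfl | rfl | rfl | rfl | rfl <;>
      (simp only [dot2, ne_eq, vec2_eq_iff] at hne ⊢; try (norm_num at hne); try norm_num)
  · refine mem_extremePoints_of_cert ![0, 1] _ (mem_of_pair 3 3 (by decide) _ (by rw [pA3, pB3, vadd2]; norm_num)) ?_
    intro y hy hne
    simp only [U12, Finset.mem_insert, Finset.mem_singleton] at hy
    rcases hy with rfl | rfl | rfl | rfl | rfl | rfl | rfl | rfl | rfl | rfl | rfl | rfl <;>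
      (simp only [dot2, ne_eq, vec2_eq_iff] at hne ⊢; try (norm_num at hne); try norm_num)
  · refine mem_extremePoints_of_cert ![-9, 5] _ (mem_of_pair 2 0 (by decide) _ (by rw [pA2, pB0, vadd2]; norm_num)) ?_
    intro y hy hne
    simp only [U12, Finset.mem_insert, Finset.mem_singleton] at hy
    rcases hy with rfl | rfl | rfl | rfl | rfl | rfl | rfl | rfl | rfl | rfl | rfl | rfl <;>
      (simp only [dot2, ne_eq, vec2_eq_iff] at hne ⊢; try (norm_num at hne); try norm_num)

/-- **Nine hull vertices**: `9 ≤ #vert conv U_2(Z)` for the pair of census parabolas over `ℤ/4` with one fibre removed. -/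
theorem nine_le_unionVert : 9 ≤ unionVert pA pB (posZ : Set (ZMod 4)) 2 := by
  have hfin : ((convexHull ℝ (unionPts pA pB (posZ : Set (ZMod 4)) 2)).extremePoints ℝ).Finite :=
    (unionPts_finite pA pB _ 2).subset extremePoints_convexHull_subset
  unfold unionVert
  calc 9 = (V9 : Set (Fin 2 → ℝ)).ncard := by rw [Set.ncard_coe_finset, card_V9]
    _ ≤ _ := Set.ncard_le_ncard V9_subset_extremePoints hfin

end CexFour

/-- **The constant `2` of the pointwise union bound is false**: `¬ ConvexUnionVertBound 2` (the census parabolas `(k, k²)`,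
`(4k, 2k²)` over `ℤ/4` with one fibre removed have `9 > 8 = 2q` hull vertices; both curves are convexly ordered). -/
theorem not_convexUnionVertBound_two : ¬ ConvexUnionVertBound 2 := by
  intro h
  have h8 := h 4 CexFour.pA CexFour.pB CexFour.convexlyOrdered_pA CexFour.convexlyOrdered_pB CexFour.posZ 2
  have h9 := CexFour.nine_le_unionVert
  omega

/-- Hence **`C ≥ 3` is necessary** in `ConvexUnionVertBound C` (strengthening `two_le_of_convexUnionVertBound`). -/
theorem three_le_of_convexUnionVertBound {C : ℕ} (h : ConvexUnionVertBound C) : 3 ≤ C := by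
  have h8 := h 4 CexFour.pA CexFour.pB CexFour.convexlyOrdered_pA CexFour.convexlyOrdered_pB CexFour.posZ 2
  have h9 := CexFour.nine_le_unionVert
  omega

end TotalsLaw

end Summit.ValiantsHypothesis.ValiantsHypothesis.Theorems.NewtonUnitEquationsDissociatedUniform
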